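import Mathlib
import HarnessLib
import Literature.Analysis.FluidPDE.SelfSimilar
import Literature.Analysis.FluidPDE.VectorCalculus
import Literature.Analysis.FluidPDE.SwirlTransportProofs
import Literature.Analysis.FluidPDE.AxisymVorticityAlgebra
import Literature.Analysis.FluidPDE.AxisymmetricVorticityTransport
import Literature.Analysis.FluidPDE.AxisymNoSwirlScalarEq
import Literature.Analysis.FluidPDE.LerayProfileCalculus
import Literature.Analysis.FluidPDE.TsaiMaximumPrinciple
import Literature.Analysis.FluidPDE.TsaiProfileEndgame
import Literature.Analysis.FluidPDE.CurlFreeLiouville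

/-!
# Route `PoloidalWindowDoor`, crux `PoloidalWindowRigidity` (K2, stmt-NavierStokesRegularity-19708) —
# ROTATED Leray profiles: the Bradshaw–Tsai obstruction is the vertical vorticity; POLOIDAL rotated
# self-similar profiles with bounded velocity are constant (slow rotation)

Cell ns-regularity-ideate, seat ns-poloidal-K2-p2 (stub-worker; `--supports` the crux, `--as helper`).  The ROTATED
backward self-similar ansatz («RSS», Perelman; Bradshaw–Tsai CPDE 42 (2017) App.; Pineau–Vicol arXiv:2607.09619
(1.7)–(1.8)) leads to the ROTATED LERAY PROFILE SYSTEM `−νΔU + aU + a DU[y] + β(DU[Jy] − JU) + DU[U] + ∇P = 0`,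
`div U = 0` on `(EuclideanSpace ℝ (Fin 3))` (`J = rotGen`; `DU[Jy] − JU = 𝓛_J U`).  Bradshaw–Tsai (after OP 5.2): for `β ≠ 0` "there does
not seem an analogue quantity of `Λ` that satisfies the maximal principle".  Here the obstruction is LOCATED and
shown to VANISH ON THE POLOIDAL CLASS (`(curl U)₂ ≡ 0`, the residue of K2):

* `driftOp_rotHead`: for the ROTATED HEAD PRESSURE `Π_β = ½|U|² + P + a⟪y,U⟫ + β⟪Jy,U⟫` (`rotHead`) and the
  drift `U + a y + βJy`, **`ν ΔΠ_β − DΠ_β[U + a y + βJy] = (ν/2)|DU − DUᵀ|² + 2νβ (curl U)₂`** (`U ∈ C³`, `P ∈ C²`;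
  `laplacian_pressure_rot`: `ΔP = −tr(DU∘DU)`, the rotation term being divergence free, `divergence_lieRot_eq_zero`;
  `sum_inner_rotGen_apply_eq`: `∑ᵢ⟪J bᵢ, DU bᵢ⟫ = (curl U)₂`).  So Tsai's (1.7) survives the rotation EXACTLY on
  poloidal fields (`driftOp_rotHead_of_poloidal`, `…_nonneg_of_poloidal`).
* `rotatedLeray_const_of_poloidal`: a bounded poloidal solution with polynomially bounded pressure and `|β| < a` has
  CONSTANT velocity — Tsai's Lemma 5.1 (tree `isConst_of_driftOp_nonneg_of_poly`, drift `(U + βJ·) + a y` of linear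
  rate `|β| < a`) makes `Π_β` constant, then `|DU − DUᵀ| ≡ 0`, `curl U ≡ 0` (`curl_eq_zero_of_spin_eq_zero`), and the
  tree's `eq_of_curl_eq_zero_of_isDivFree_of_bounded` ends.  The case `|β| ≥ a` needs Lemma 5.1 with the tangential
  drift `βJy` (orthogonal to `y − x₀` up to the constant `βJx₀` about every centre) — not done here.

WHAT THIS IS NOT: not a claim about Navier–Stokes regularity; not Perelman's problem for general profiles (the term
`2νβω₂` is exactly what is missing there) — the poloidal, slowly rotating case (bears_on LADDER-NS N0).
-/


noncomputable section

-- the summit and its single sub-problem share the name (CONVENTIONS §1), as in every Theorems file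
set_option linter.dupNamespace false

namespace Summit.NavierStokesRegularity.NavierStokesRegularity.Theorems.PoloidalWindowDoorPoloidalWindowRigidityRotatedLeray

open MeasureTheory Set Function Filter Topology TopologicalSpace Metric InnerProductSpace
open scoped RealInnerProductSpace InnerProductSpace Laplacian ContDiff
open Literature.Analysis Literature.Analysis.FluidPDE

variable {ν a β : ℝ} {U : (EuclideanSpace ℝ (Fin 3)) → (EuclideanSpace ℝ (Fin 3))} {P : (EuclideanSpace ℝ (Fin 3)) → ℝ}

/-! ### the rotation generator -/

/-- The adjoint of `rotGenL` is `−rotGenL`. -/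
theorem adjoint_rotGenL : ContinuousLinearMap.adjoint rotGenL = -rotGenL := by
  refine ContinuousLinearMap.ext fun v => ?_
  refine ext_inner_right ℝ fun w => ?_
  rw [ContinuousLinearMap.adjoint_inner_left]
  simp only [_root_.neg_apply, rotGenL_apply, inner_neg_left]
  rw [inner_rotGen_left_eq_neg, neg_neg]

/-- The derivative of `rotGen` is `rotGenL`. -/
theorem fderiv_rotGen (x : (EuclideanSpace ℝ (Fin 3))) : fderiv ℝ rotGen x = rotGenL := (hasFDerivAt_rotGen x).fderiv

/-- `rotGen` (linear) has vanishing Laplacian. -/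
theorem laplacian_rotGen (x : (EuclideanSpace ℝ (Fin 3))) : (Δ rotGen) x = 0 := by
  set b := stdOrthonormalBasis ℝ (EuclideanSpace ℝ (Fin 3))
  rw [laplacian_eq_sum_fderiv_fderiv b (contDiff_rotGen (n := 2)) x]
  refine Finset.sum_eq_zero fun i _ => ?_
  have : (fun y : (EuclideanSpace ℝ (Fin 3)) => fderiv ℝ rotGen y (b i)) = fun _ => rotGenL (b i) := by
    funext y; rw [fderiv_rotGen]
  rw [this, fderiv_fun_const]
  rfl

/-- **`tr(Jᵀ ∘ DU) = ∑ᵢ ⟪J bᵢ, DU bᵢ⟫ = (curl U)₂`**: the pairing of the rotation generator with the Jacobian is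
the vertical vorticity (computed in the standard basis: `⟪e₁, DU e₀⟫ − ⟪e₀, DU e₁⟫ = ∂₀U₁ − ∂₁U₀`). -/
theorem sum_inner_rotGen_fderiv (L : (EuclideanSpace ℝ (Fin 3)) →L[ℝ] (EuclideanSpace ℝ (Fin 3))) :
    ∑ i, ⟪rotGen (EuclideanSpace.basisFun (Fin 3) ℝ i), L (EuclideanSpace.basisFun (Fin 3) ℝ i)⟫ =
      L (EuclideanSpace.single 0 1) 1 - L (EuclideanSpace.single 1 1) 0 := by
  simp only [Fin.sum_univ_three, EuclideanSpace.basisFun_apply, rotGen_single_zero, rotGen_single_one,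
    rotGen_single_two, inner_zero_left, add_zero, inner_neg_left, EuclideanSpace.inner_single_left, one_mul,
    conj_trivial]
  ring

/-- The vertical vorticity in terms of the Jacobian: `(curl U x)₂ = DU(x)[e₀]₁ − DU(x)[e₁]₀`. -/
theorem curl_apply_two' (x : (EuclideanSpace ℝ (Fin 3))) :
    curl U x 2 = fderiv ℝ U x (EuclideanSpace.single 0 1) 1 - fderiv ℝ U x (EuclideanSpace.single 1 1) 0 := by
  simp [curl]

/-- The basis-free form: for ANY orthonormal basis `b`, `∑ᵢ ⟪J bᵢ, L bᵢ⟫ = (curl U)₂` when `L = DU(x)`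
(the sum is `−tr(J ∘ L)`, independent of the basis). -/
theorem sum_inner_rotGen_eq_neg_trace {ι : Type*} [Fintype ι] (b : OrthonormalBasis ι ℝ (EuclideanSpace ℝ (Fin 3))) (L : (EuclideanSpace ℝ (Fin 3)) →L[ℝ] (EuclideanSpace ℝ (Fin 3))) :
    ∑ i, ⟪rotGen (b i), L (b i)⟫ = -traceCLM (rotGenL.comp L) := by
  rw [traceCLM_eq_sum_inner b, ← Finset.sum_neg_distrib]
  refine Finset.sum_congr rfl fun i _ => ?_
  rw [ContinuousLinearMap.comp_apply, rotGenL_apply, inner_rotGen_left_eq_neg, ← inner_rotGen_left_eq_neg, inner_rotGen_left_eq_neg]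

/-- For ANY orthonormal basis `b`: `∑ᵢ ⟪J bᵢ, L bᵢ⟫ = L(e₀)₁ − L(e₁)₀` (`= (curl U)₂` for `L = DU`). -/
theorem sum_inner_rotGen_apply_eq {ι : Type*} [Fintype ι] (b : OrthonormalBasis ι ℝ (EuclideanSpace ℝ (Fin 3))) (L : (EuclideanSpace ℝ (Fin 3)) →L[ℝ] (EuclideanSpace ℝ (Fin 3))) :
    ∑ i, ⟪rotGen (b i), L (b i)⟫ = L (EuclideanSpace.single 0 1) 1 - L (EuclideanSpace.single 1 1) 0 := by
  rw [sum_inner_rotGen_eq_neg_trace b, ← sum_inner_rotGen_eq_neg_trace (EuclideanSpace.basisFun (Fin 3) ℝ),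
    sum_inner_rotGen_fderiv]

/-! ### the rotated head pressure -/

/-- `Π_β` as a sum of functions. -/
theorem rotHead_eq_add (a β : ℝ) (U : EuclideanSpace ℝ (Fin 3) → EuclideanSpace ℝ (Fin 3))
    (P : EuclideanSpace ℝ (Fin 3) → ℝ) :
    (fun z : EuclideanSpace ℝ (Fin 3) => headPressure a U P z + β * ⟪rotGen z, U z⟫) =
      headPressure a U P + (β • fun y => ⟪rotGen y, U y⟫) := by
  funext y; simp [smul_eq_mul]

/-- The rotational moment `⟪J·, U⟫` is as smooth as `U`. -/
theorem contDiff_rotMoment {n : ℕ∞} (hU : ContDiff ℝ n U) : ContDiff ℝ n fun y : (EuclideanSpace ℝ (Fin 3)) => ⟪rotGen y, U y⟫ :=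
  (contDiff_rotGen (n := n)).inner ℝ hU

/-- `Π_β` is as smooth as `U` and `P`. -/
theorem contDiff_rotHead {n : ℕ∞} (hU : ContDiff ℝ n U) (hP : ContDiff ℝ n P) :
    ContDiff ℝ n (fun z : EuclideanSpace ℝ (Fin 3) => headPressure a U P z + β * ⟪rotGen z, U z⟫) := by
  rw [rotHead_eq_add]
  exact (contDiff_headPressure hU hP).add (contDiff_const.smul (contDiff_rotMoment hU))

/-- Gradient of the rotational moment: `D⟪J·, U⟫(y)[w] = ⟪Jw, U⟫ + ⟪Jy, DU w⟫`. -/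
theorem fderiv_rotMoment_apply (hU : Differentiable ℝ U) (y w : (EuclideanSpace ℝ (Fin 3))) :
    fderiv ℝ (fun y : (EuclideanSpace ℝ (Fin 3)) => ⟪rotGen y, U y⟫) y w = ⟪rotGen w, U y⟫ + ⟪rotGen y, fderiv ℝ U y w⟫ := by
  have hJ : DifferentiableAt ℝ rotGen y := (hasFDerivAt_rotGen y).differentiableAt
  rw [fderiv_inner_apply ℝ hJ (hU y), fderiv_rotGen, rotGenL_apply, real_inner_comm (U y)]
  ring

/-- Laplacian of the rotational moment: `Δ⟪J·, U⟫ = ⟪Jy, ΔU⟫ + 2 (curl U)₂`. -/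
theorem laplacian_rotMoment (hU : ContDiff ℝ 2 U) (x : (EuclideanSpace ℝ (Fin 3))) :
    (Δ fun y : (EuclideanSpace ℝ (Fin 3)) => ⟪rotGen y, U y⟫) x = ⟪rotGen x, (Δ U) x⟫ + 2 * curl U x 2 := by
  set b := stdOrthonormalBasis ℝ (EuclideanSpace ℝ (Fin 3))
  rw [laplacian_inner_eq b (contDiff_rotGen (n := 2)) hU x, laplacian_rotGen, inner_zero_left, zero_add,
    curl_apply_two']
  have : ∑ i, ⟪fderiv ℝ rotGen x (b i), fderiv ℝ U x (b i)⟫ = ∑ i, ⟪rotGen (b i), fderiv ℝ U x (b i)⟫ :=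
    Finset.sum_congr rfl fun i _ => by rw [fderiv_rotGen, rotGenL_apply]
  rw [this, sum_inner_rotGen_apply_eq b]

/-! ### the rotated profile system: pressure Poisson equation -/

/-- **The rotation term is divergence free**: `div (y ↦ DU(y)[Jy] − J U(y)) = 0` for `U ∈ C²` with `div U = 0`
(`div (DU[J·]) = D(div U)[Jy] + tr(DU ∘ J)` and `div (J ∘ U) = tr(J ∘ DU)`, equal traces). -/
theorem divergence_lieRot_eq_zero (hU : ContDiff ℝ 2 U) (hdiv : VectorCalculus.IsDivFree U) (y : (EuclideanSpace ℝ (Fin 3))) :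
    VectorCalculus.divergence (fun x => fderiv ℝ U x (rotGen x) - rotGen (U x)) y = 0 := by
  have hU1 : ContDiff ℝ 1 U := hU.of_le one_le_two
  have hUd : Differentiable ℝ U := hU1.differentiable one_ne_zero
  have hDUd : Differentiable ℝ (fderiv ℝ U) := (hU.fderiv_right (m := 1) le_rfl).differentiable one_ne_zero
  have hJd : ∀ x, DifferentiableAt ℝ rotGen x := fun x => (hasFDerivAt_rotGen x).differentiableAt
  have hA : DifferentiableAt ℝ (fun x => fderiv ℝ U x (rotGen x)) y := (hDUd y).clm_apply (hJd y)
  have hB : DifferentiableAt ℝ (fun x => rotGen (U x)) y := (hJd (U y)).comp y (hUd y)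
  rw [divergence_sub_apply hA hB]
  -- `div (DU[J·]) = tr((DU y) ∘ J) + tr((D²U y)(·)(Jy))`
  have h1 : VectorCalculus.divergence (fun x => fderiv ℝ U x (rotGen x)) y =
      traceCLM ((fderiv ℝ U y).comp rotGenL) + traceCLM ((fderiv ℝ (fderiv ℝ U) y).flip (rotGen y)) := by
    rw [divergence_eq_traceCLM, fderiv_clm_apply (hDUd y) (hJd y), map_add, fderiv_rotGen]
  -- the second trace is `D(div U)[Jy] = 0`
  have hsymm : traceCLM ((fderiv ℝ (fderiv ℝ U) y).flip (rotGen y)) =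
      fderiv ℝ (VectorCalculus.divergence U) y (rotGen y) := by
    rw [fderiv_divergence_apply hU]
    congr 1
    refine ContinuousLinearMap.ext fun u => ?_
    simp only [ContinuousLinearMap.flip_apply]
    exact (hU.contDiffAt.isSymmSndFDerivAt (n := 2) (by simp)) u (rotGen y)
  have hdiv0 : VectorCalculus.divergence U = fun _ => (0 : ℝ) := funext hdiv
  have h2 : VectorCalculus.divergence (fun x => rotGen (U x)) y = traceCLM (rotGenL.comp (fderiv ℝ U y)) := by
    rw [divergence_eq_traceCLM]
    congr 1
    have : (fun x => rotGen (U x)) = fun x => rotGenL (U x) := funext fun x => (rotGenL_apply _).symm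
    rw [this]
    exact (rotGenL.hasFDerivAt.comp y (hUd y).hasFDerivAt).fderiv
  rw [h1, hsymm, hdiv0, h2]
  simp only [fderiv_fun_const, Pi.zero_apply, _root_.zero_apply, add_zero]
  -- `tr(A ∘ B) = tr(B ∘ A)`
  rw [traceCLM_apply, traceCLM_apply]
  have e1 : ((fderiv ℝ U y).comp rotGenL : (EuclideanSpace ℝ (Fin 3)) →ₗ[ℝ] (EuclideanSpace ℝ (Fin 3))) = (fderiv ℝ U y : (EuclideanSpace ℝ (Fin 3)) →ₗ[ℝ] (EuclideanSpace ℝ (Fin 3))).comp (rotGenL : (EuclideanSpace ℝ (Fin 3)) →ₗ[ℝ] (EuclideanSpace ℝ (Fin 3))) := rfl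
  have e2 : (rotGenL.comp (fderiv ℝ U y) : (EuclideanSpace ℝ (Fin 3)) →ₗ[ℝ] (EuclideanSpace ℝ (Fin 3))) = (rotGenL : (EuclideanSpace ℝ (Fin 3)) →ₗ[ℝ] (EuclideanSpace ℝ (Fin 3))).comp (fderiv ℝ U y : (EuclideanSpace ℝ (Fin 3)) →ₗ[ℝ] (EuclideanSpace ℝ (Fin 3))) := rfl
  rw [e1, e2, LinearMap.trace_comp_comm', sub_self]

/-- **Pressure Poisson equation of the rotated system**: `ΔP = −tr(DU ∘ DU)` (the rotation term is divergence
free; the rest as for Leray profiles, tree `IsLerayProfile.laplacian_pressure_eq`). -/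
theorem laplacian_pressure_rot (hU3 : ContDiff ℝ 3 U) (hP2 : ContDiff ℝ 2 P)
    (hpe : ∀ y, -(ν • (Δ U) y) + a • U y + a • fderiv ℝ U y y + β • (fderiv ℝ U y (rotGen y) - rotGen (U y)) +
      convect U U y + gradient P y = 0)
    (hdiv : VectorCalculus.IsDivFree U) (y : (EuclideanSpace ℝ (Fin 3))) :
    (Δ P) y = -traceCLM ((fderiv ℝ U y).comp (fderiv ℝ U y)) := by
  have hU2 : ContDiff ℝ 2 U := hU3.of_le (by norm_num)
  have hU1 : ContDiff ℝ 1 U := hU3.of_le (by norm_num)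
  have hUd : Differentiable ℝ U := hU1.differentiable one_ne_zero
  have hDUd : Differentiable ℝ (fderiv ℝ U) := (hU2.fderiv_right (m := 1) le_rfl).differentiable one_ne_zero
  have hJd : ∀ x, DifferentiableAt ℝ rotGen x := fun x => (hasFDerivAt_rotGen x).differentiableAt
  have hgradP : gradient P = fun x => ν • (Δ U) x - a • U x - a • fderiv ℝ U x x -
      β • (fderiv ℝ U x (rotGen x) - rotGen (U x)) - convect U U x := by
    funext x
    have hx := hpe x
    rw [← sub_eq_zero, ← hx]
    abel
  rw [← divergence_gradient hP2 y, hgradP]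
  have hdA : DifferentiableAt ℝ (fun x => ν • (Δ U) x) y := ((differentiable_laplacian hU3) y).const_smul ν
  have hdB : DifferentiableAt ℝ (fun x => a • U x) y := (hUd y).const_smul a
  have hdC' : DifferentiableAt ℝ (fun x => fderiv ℝ U x x) y := (hDUd y).clm_apply differentiableAt_fun_id
  have hdC : DifferentiableAt ℝ (fun x => a • fderiv ℝ U x x) y := hdC'.const_smul a
  have hdR' : DifferentiableAt ℝ (fun x => fderiv ℝ U x (rotGen x) - rotGen (U x)) y :=
    ((hDUd y).clm_apply (hJd y)).sub ((hJd (U y)).comp y (hUd y))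
  have hdR : DifferentiableAt ℝ (fun x => β • (fderiv ℝ U x (rotGen x) - rotGen (U x))) y := hdR'.const_smul β
  have hdD : DifferentiableAt ℝ (convect U U) y := (hDUd y).clm_apply (hUd y)
  have hdAB : DifferentiableAt ℝ (fun x => ν • (Δ U) x - a • U x) y := hdA.sub hdB
  have hdABC : DifferentiableAt ℝ (fun x => ν • (Δ U) x - a • U x - a • fderiv ℝ U x x) y := hdAB.sub hdC
  have hdABCR : DifferentiableAt ℝ (fun x => ν • (Δ U) x - a • U x - a • fderiv ℝ U x x -
      β • (fderiv ℝ U x (rotGen x) - rotGen (U x))) y := hdABC.sub hdR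
  rw [divergence_sub_apply hdABCR hdD, divergence_sub_apply hdABC hdR, divergence_sub_apply hdAB hdC,
    divergence_sub_apply hdA hdB, divergence_const_smul_apply ((differentiable_laplacian hU3) y),
    divergence_const_smul_apply (hUd y), divergence_const_smul_apply hdC', divergence_const_smul_apply hdR',
    divergence_laplacian_eq_zero hU3 hdiv, hdiv y,
    divergence_fderiv_apply_self_eq_zero hU2 hdiv, divergence_lieRot_eq_zero hU2 hdiv,
    divergence_convect_self_eq hU2 hdiv]
  ring

/-! ### the identity: Tsai's (1.7) with rotation -/

/-- **The rotated head-pressure identity.** For a solution of the rotated Leray system (`U ∈ C³`, `P ∈ C²`),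
`ν ΔΠ_β − DΠ_β[U + a y + βJy] = (ν/2)|DU − DUᵀ|² + 2νβ (curl U)₂`: Tsai's (1.7) plus ONE extra term, the vertical
vorticity.  (In the form of the tree's `driftOp`, with the bounded-plus-tangential field `U + βJ·` as drift.) -/
theorem driftOp_rotHead (hU3 : ContDiff ℝ 3 U) (hP2 : ContDiff ℝ 2 P)
    (hpe : ∀ y, -(ν • (Δ U) y) + a • U y + a • fderiv ℝ U y y + β • (fderiv ℝ U y (rotGen y) - rotGen (U y)) +
      convect U U y + gradient P y = 0)
    (hdiv : VectorCalculus.IsDivFree U) (y : (EuclideanSpace ℝ (Fin 3))) :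
    driftOp ν a (fun z => U z + β • rotGen z) ((fun z : EuclideanSpace ℝ (Fin 3) => headPressure a U P z + β * ⟪rotGen z, U z⟫)) y =
      ν / 2 * frobeniusNormSq (spin U y) + 2 * ν * β * curl U y 2 := by
  have hU2 : ContDiff ℝ 2 U := hU3.of_le (by norm_num)
  have hU1 : ContDiff ℝ 1 U := hU3.of_le (by norm_num)
  have hUd : Differentiable ℝ U := hU1.differentiable one_ne_zero
  have hPd : Differentiable ℝ P := (hP2.of_le one_le_two).differentiable one_ne_zero
  have hΔP := laplacian_pressure_rot hU3 hP2 hpe hdiv y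
  have hMc : ContDiff ℝ 2 fun z : (EuclideanSpace ℝ (Fin 3)) => ⟪rotGen z, U z⟫ := contDiff_rotMoment hU2
  have hMc' : ContDiff ℝ 2 (β • fun z : (EuclideanSpace ℝ (Fin 3)) => ⟪rotGen z, U z⟫) := contDiff_const.smul hMc
  have hHc : ContDiff ℝ 2 (headPressure a U P) := contDiff_headPressure hU2 hP2
  -- Laplacian and gradient of `Π_β`
  have hLap : (Δ ((fun z : EuclideanSpace ℝ (Fin 3) => headPressure a U P z + β * ⟪rotGen z, U z⟫))) y = (Δ (headPressure a U P)) y + β * (Δ fun z : (EuclideanSpace ℝ (Fin 3)) => ⟪rotGen z, U z⟫) y := by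
    rw [rotHead_eq_add, hHc.contDiffAt.laplacian_add hMc'.contDiffAt, laplacian_smul _ hMc.contDiffAt, smul_eq_mul]
  have hDer : ∀ w, fderiv ℝ ((fun z : EuclideanSpace ℝ (Fin 3) => headPressure a U P z + β * ⟪rotGen z, U z⟫)) y w =
      fderiv ℝ (headPressure a U P) y w + β * fderiv ℝ (fun z : (EuclideanSpace ℝ (Fin 3)) => ⟪rotGen z, U z⟫) y w := by
    intro w
    rw [rotHead_eq_add]
    have h1 : DifferentiableAt ℝ (headPressure a U P) y :=
      ((contDiff_headPressure hU1 (hP2.of_le one_le_two)).differentiable one_ne_zero) y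
    have h2 : DifferentiableAt ℝ (fun z : (EuclideanSpace ℝ (Fin 3)) => ⟪rotGen z, U z⟫) y :=
      ((contDiff_rotMoment hU1).differentiable one_ne_zero) y
    rw [fderiv_add h1 (h2.const_smul β), fderiv_const_smul h2]
    simp [smul_eq_mul]
  have hLapHead := laplacian_headPressure (a := a) hU2 hP2 y
  have hDerHead := fderiv_headPressure_apply (a := a) hUd hPd y (U y + β • rotGen y + a • y)
  have hLapM := laplacian_rotMoment hU2 y
  have hDerM := fderiv_rotMoment_apply hUd y (U y + β • rotGen y + a • y)
  -- the profile equation dotted with `U`, `y`, `Jy`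
  have hEU : ⟪-(ν • (Δ U) y) + a • U y + a • fderiv ℝ U y y + β • (fderiv ℝ U y (rotGen y) - rotGen (U y)) +
      convect U U y + gradient P y, U y⟫ = 0 := by rw [hpe y, inner_zero_left]
  have hEy : ⟪-(ν • (Δ U) y) + a • U y + a • fderiv ℝ U y y + β • (fderiv ℝ U y (rotGen y) - rotGen (U y)) +
      convect U U y + gradient P y, y⟫ = 0 := by rw [hpe y, inner_zero_left]
  have hEJ : ⟪-(ν • (Δ U) y) + a • U y + a • fderiv ℝ U y y + β • (fderiv ℝ U y (rotGen y) - rotGen (U y)) +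
      convect U U y + gradient P y, rotGen y⟫ = 0 := by rw [hpe y, inner_zero_left]
  simp only [inner_add_left, inner_sub_left, inner_neg_left, real_inner_smul_left, convect_apply, gradient,
    InnerProductSpace.toDual_symm_apply] at hEU hEy hEJ
  have hspin : frobeniusNormSq (spin U y) =
      2 * (frobeniusNormSq (fderiv ℝ U y) - traceCLM ((fderiv ℝ U y).comp (fderiv ℝ U y))) :=
    frobeniusNormSq_sub_adjoint _
  -- skewness facts: `⟪J U, U⟫ = 0`, `⟪Jy, y⟫ = 0`, `⟪J U, y⟫ = −⟪Jy, U⟫`, `⟪J U, J y⟫`…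
  have s1 : ⟪rotGen (U y), U y⟫ = 0 := inner_rotGen_self _
  have s2 : ⟪rotGen y, y⟫ = 0 := inner_rotGen_self _
  have s3 : ⟪rotGen (U y), y⟫ = -⟪U y, rotGen y⟫ := inner_rotGen_left_eq_neg _ _
  have s4 : ⟪rotGen (U y), rotGen y⟫ = -⟪U y, rotGen (rotGen y)⟫ := inner_rotGen_left_eq_neg _ _
  rw [driftOp, hLap, hDer, hLapHead, hDerHead, hLapM, hDerM, hΔP, hdiv y, hspin]
  simp only [map_add, map_smul, inner_add_right, inner_add_left, real_inner_smul_right, real_inner_smul_left,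
    smul_eq_mul, rotGen_add, rotGen_smul]
  set L : (EuclideanSpace ℝ (Fin 3)) := (Δ U : (EuclideanSpace ℝ (Fin 3)) → (EuclideanSpace ℝ (Fin 3))) y with hL
  -- orient the inner products of the three scalar equations as in the goal
  have c3 : ⟪rotGen (U y), y⟫ = -⟪rotGen y, U y⟫ := by
    rw [inner_rotGen_left, inner_rotGen_left]; ring
  have c5 : ⟪rotGen (U y), rotGen y⟫ = -⟪rotGen (rotGen y), U y⟫ := by
    rw [inner_rotGen_left, inner_rotGen_left]
    simp only [rotGen_apply_zero, rotGen_apply_one]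
    ring
  rw [real_inner_comm (U y) (fderiv ℝ U y y), real_inner_comm (U y) (fderiv ℝ U y (U y)),
    real_inner_comm (U y) (fderiv ℝ U y (rotGen y)), s1] at hEU
  rw [real_inner_comm y L, real_inner_comm y (U y), real_inner_comm y (fderiv ℝ U y y),
    real_inner_comm y (fderiv ℝ U y (U y)), real_inner_comm y (fderiv ℝ U y (rotGen y)), c3] at hEy
  rw [real_inner_comm (rotGen y) L, real_inner_comm (rotGen y) (U y), real_inner_comm (rotGen y) (fderiv ℝ U y y),
    real_inner_comm (rotGen y) (fderiv ℝ U y (rotGen y)), real_inner_comm (rotGen y) (fderiv ℝ U y (U y)),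
    c5] at hEJ
  rw [s1]
  linear_combination (-1 : ℝ) * hEU - a * hEy - β * hEJ

/-- **On the poloidal class the rotated head pressure satisfies Tsai's (1.7) exactly**:
`ν ΔΠ_β − DΠ_β[U + a y + βJy] = (ν/2)|DU − DUᵀ|²`. -/
theorem driftOp_rotHead_of_poloidal (hU3 : ContDiff ℝ 3 U) (hP2 : ContDiff ℝ 2 P)
    (hpe : ∀ y, -(ν • (Δ U) y) + a • U y + a • fderiv ℝ U y y + β • (fderiv ℝ U y (rotGen y) - rotGen (U y)) +
      convect U U y + gradient P y = 0)
    (hdiv : VectorCalculus.IsDivFree U) (hpol : ∀ y, curl U y 2 = 0) (y : (EuclideanSpace ℝ (Fin 3))) :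
    driftOp ν a (fun z => U z + β • rotGen z) ((fun z : EuclideanSpace ℝ (Fin 3) => headPressure a U P z + β * ⟪rotGen z, U z⟫)) y = ν / 2 * frobeniusNormSq (spin U y) := by
  rw [driftOp_rotHead hU3 hP2 hpe hdiv y, hpol y, mul_zero, add_zero]

/-- Hence `Π_β` is a subsolution of the drift–Laplace operator (`ν ≥ 0`), the hypothesis of Tsai's Lemma 5.1. -/
theorem driftOp_rotHead_nonneg_of_poloidal (hν : 0 ≤ ν) (hU3 : ContDiff ℝ 3 U) (hP2 : ContDiff ℝ 2 P)
    (hpe : ∀ y, -(ν • (Δ U) y) + a • U y + a • fderiv ℝ U y y + β • (fderiv ℝ U y (rotGen y) - rotGen (U y)) +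
      convect U U y + gradient P y = 0)
    (hdiv : VectorCalculus.IsDivFree U) (hpol : ∀ y, curl U y 2 = 0) (y : (EuclideanSpace ℝ (Fin 3))) :
    0 ≤ driftOp ν a (fun z => U z + β • rotGen z) ((fun z : EuclideanSpace ℝ (Fin 3) => headPressure a U P z + β * ⟪rotGen z, U z⟫)) y := by
  rw [driftOp_rotHead_of_poloidal hU3 hP2 hpe hdiv hpol y]
  exact mul_nonneg (by positivity) (frobeniusNormSq_nonneg _)

end Summit.NavierStokesRegularity.NavierStokesRegularity.Theorems.PoloidalWindowDoorPoloidalWindowRigidityRotatedLeray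

end
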